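import Mathlib.Algebra.Order.Interval.Basic
import Mathlib.Order.Interval.Basic
import Mathlib.Data.Rat.Cast.Order
import Mathlib.Data.Real.Basic
import Mathlib.Data.Fintype.Basic
import Mathlib.Data.Finset.Basic
import Mathlib.Data.Fin.VecNotation
import Literature.Analysis.ValidatedNumerics.IntervalEnclosure
import HarnessLib

/-!
# Scale data: the certificate interface of an a-posteriori criterion for `U(1)` order

Topic `Literature/MathematicalPhysics/QuantumLattice`; definition request `defn-HubbardScaleData`
(route HubbardSuperconductivity/AposterioriCapRg, cruxes `AposterioriOrderCriterion` =
stmt-HubbardSuperconductivity-1381 and `CapRgScaleData` = stmt-HubbardSuperconductivity-1375;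
the requester's intended home was `Summits/…/Theorems`, but definition topics are Literature and
the object is model-independent — a librarian may re-home it).

## What this is

The route posits a NEW OBJECT in the format of the *a-posteriori* theorems of computer-assisted
analysis — hypotheses = finitely many inequalities on a computable object (Figueras–Haro–Luque
2016, Thm. 2.5: "the hypotheses … are tailored to be verified with a finite amount of
computations"; Lanford 1982; Koch–Wittwer 1994), whose gapped analogues are the finite-size gap
criteria of Knabe (1988) and Gosset–Mozgunov (2016). The computable object is a **scale datum**: a
finite record of closed intervals with RATIONAL end points describing the Wilsonian effective
action of a lattice fermion model with pair seed `h` (for the route: `dWaveSourceTorus L U μ h`)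
at ONE infrared scale `Λ₀` — the number `N_p` of Fermi-curve patches with, per patch, an enclosure
of the (`B₁g`) gap function and the set of patches declared NODAL (Dirac cone instead of a gap);
enclosures of the phase stiffness `ρ_s(Λ₀, h)` (helicity modulus, Fisher–Barber–Jasnow 1973) and
of the pair compressibility `κ(Λ₀, h)` of the phase (rotor / XY) part of the action; of the nodal
velocities `(v_F, v_Δ)`; of the norm `η(Λ₀, h)` of the remainder (everything not kept, in a
weighted norm of Grassmann kernels à la Salmhofer 1998); and of the mean-field anomalous density
`m₀` of the truncated action (the number a criterion turns into a bound on the order parameter).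

## Contents (namespace `Literature.MathematicalPhysics.QuantumLattice`)

* `HubbardScaleData` — the certificate record (scale `Λ₀ > 0`, `N_p`, nodal set, enclosures).
* `HubbardScaleData.Parameters Np` — the REAL tuple `(Δ on patches, ρ_s, κ, v_F, v_Δ, η, m₀)` a
  datum encloses; `HubbardScaleData.Encloses D p` — each coordinate of `p` lies in its interval.
* `HubbardScaleData.Report Np := ℕ → ℝ → Set (Parameters Np)` — for each volume `L` and inverse
  temperature `β`, the parameter tuples REALISED by the model's effective action at the scale (the
  semantic side, supplied by the model; see "NOT here").
* `HubbardScaleData.IsCertifiedEnclosure D R L₀` — for all `L ≥ L₀` there is `β₀(L)` such that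
  for all `β ≥ β₀(L)` some realised tuple is enclosed by `D` (ONE datum, uniformly in `L`, `β`).
* `HubbardScaleData.MeetsThresholdsWith D c K η`, `MeetsThresholds D K η := MeetsThresholdsWith D
  10 K η` — the threshold inequalities of the criterion, worst case over the enclosures, in
  polynomial (division- and root-free) form: `ρ_s / (Λ₀ · max(v_F, v_Δ, √(ρ_s/κ))) ≥ K` as
  `K Λ₀ v_F ≤ ρ_s`, `K Λ₀ v_Δ ≤ ρ_s`, `(K Λ₀)² ≤ ρ_s κ`; `|Δ| ≥ c Λ₀` on every non-nodal patch
  (`c = 10` as requested); `η ≤ η*`; plus the sign conditions `κ, v_F, v_Δ > 0` that make the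
  quotients meaningful. Rational thresholds, hence DECIDABLE: a concrete certificate is checked by
  kernel computation (`decide +kernel`, closing `example`).
* API: unfolding, monotonicity (in `L₀`, in the report, in the thresholds), and the pointwise
  consequences `MeetsThresholdsWith → Encloses p → …` turning a checked certificate into real
  inequalities on realised parameters (what a proof of the criterion consumes).

## Intended use by the route (orientation only; nothing of this is asserted here)

With a model report `R U μ Λ₀ h : HubbardScaleData.Report D.numPatches` ("the effective action at
scale `Λ₀` of `dWaveSourceTorus L U μ h` at inverse temperature `β` has the phase + quasiparticle
form with parameters `p`") the cruxes become one-liners: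
`AposterioriOrderCriterion := ∃ K η, 0 < η ∧ ∀ U μ h₀ L₀ (D : HubbardScaleData),
  (∀ h ∈ Set.Ioc 0 h₀, D.IsCertifiedEnclosure (R U μ D.scale h) L₀) → D.MeetsThresholds K η →
  (D.meanFieldDensity.fst : ℝ) / 2 ≤ dWaveOrderParameter U μ`;
`CapRgScaleData := ∃ U ∈ Icc 2 3, ∃ δ ∈ Icc (1/5) (7/20), ∃ μ h₀ L₀ D, (density → 1 - δ) ∧
  (∀ h ∈ Set.Ioc 0 h₀, D.IsCertifiedEnclosure (R U μ D.scale h) L₀) ∧ D.MeetsThresholds K η`.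

## Design choices

* INTERFACE ONLY: no instance is asserted to exist (construction crux `CapRgScaleData`), no
  criterion is asserted (crux `AposterioriOrderCriterion`); no defaulted fields.
* Rational end points (exact, decidable, what interval arithmetic outputs) enclosing REAL
  quantities through `NonemptyInterval.ratCast ℝ` of `Literature.Analysis.ValidatedNumerics`
  (Moore 1966); Mathlib's `NonemptyInterval` (order = containment) is the interval type.
* `Λ₀` is a field of the datum (thresholds are ratios to `Λ₀`), so the predicates do not take it.
* The meaning of "nodal" is fixed by the REPORT, not by the datum: declaring a gapped patch nodal
  changes what the report must realise there (a Dirac cone with the recorded velocities), so a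
  dishonest nodal set makes `IsCertifiedEnclosure` fail rather than the thresholds vacuous.
* Remainder and mean-field density are two-sided enclosures like everything else; only
  `remainderNorm.snd` and `meanFieldDensity.fst` enter thresholds / conclusions.
* `β₀` may depend on `L` (`∀ L, ∃ β₀, ∀ β ≥ β₀`), as requested ("`L ≥ L₀` and `β ≥ β₀(L)`").

## NOT here (deliberately)

* The MODEL REPORT binding a datum to the Hubbard model — the predicate "the scale-`Λ₀` effective
  action of `dWaveSourceTorus L U μ h` (sibling request `defn-hubbardEffectiveAction`: Grassmann
  representation, scale decomposition, Salmhofer norms) has the form `S_phase[θ; ρ_s, κ] +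
  S_qp[Δ, v_F, v_Δ] + S_mix + S_rem`, `‖S_rem‖_{Λ₀} ≤ η`" — needs that sibling and a phase–
  quasiparticle normal form no tree file defines yet; it enters only as `R : Report Np`.
* Numerical values of `K*`, `η*`; patch geometry (Fermi-curve sectors à la Feldman–Knörrer–
  Trubowitz are the constructor's choice, recorded only through `N_p`); any claim about the 2D
  Hubbard model.

## Sources (format precedents only — the object itself is posited by the route)

Figueras–Haro–Luque, Found. Comput. Math. 17 (2017) 1123, Thm. 2.5; Knabe, J. Stat. Phys. 52
(1988) 627; Gosset–Mozgunov, J. Math. Phys. 57 (2016); Salmhofer, Comm. Math. Phys. 194 (1998)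
249, §§2–3 (effective action, remainder bounds); Fisher–Barber–Jasnow, Phys. Rev. A 8 (1973) 1111
(helicity modulus); Moore, *Interval Analysis* (1966), Ch. 2 (enclosures).
-/

namespace Literature.MathematicalPhysics.QuantumLattice

open NonemptyInterval

/-! ### The certificate record -/

/-- **Scale data** (the certificate of the a-posteriori order criterion of route
AposterioriCapRg): an infrared scale `Λ₀ > 0`, a number `N_p` of Fermi-curve patches with the
subset declared nodal, and closed intervals with rational end points enclosing the gap function on
each patch, the phase stiffness `ρ_s`, the pair compressibility `κ`, the nodal velocities
`v_F, v_Δ`, the remainder norm `η` and the mean-field anomalous density `m₀` of the effective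
action at scale `Λ₀`. A finite, computable object; nothing about any model is asserted by
inhabiting it (a-posteriori format: Figueras–Haro–Luque 2016, Thm. 2.5; Knabe 1988). [folklore] -/
structure HubbardScaleData where
  /-- The infrared scale `Λ₀`. -/
  scale : ℚ
  /-- `Λ₀ > 0`. -/
  scale_pos : 0 < scale
  /-- The number `N_p` of Fermi-curve patches. -/
  numPatches : ℕ
  /-- The patches declared nodal (Dirac cones; their gap is not thresholded). -/
  nodal : Finset (Fin numPatches)
  /-- Enclosure of the gap function on each patch. -/
  gap : Fin numPatches → NonemptyInterval ℚ
  /-- Enclosure of the phase stiffness `ρ_s(Λ₀, h)`. -/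
  stiffness : NonemptyInterval ℚ
  /-- Enclosure of the pair compressibility `κ(Λ₀, h)`. -/
  compressibility : NonemptyInterval ℚ
  /-- Enclosure of the nodal Fermi velocity `v_F`. -/
  fermiVelocity : NonemptyInterval ℚ
  /-- Enclosure of the nodal gap velocity `v_Δ`. -/
  gapVelocity : NonemptyInterval ℚ
  /-- Enclosure of the remainder norm `η(Λ₀, h)` (in practice `[0, η]`). -/
  remainderNorm : NonemptyInterval ℚ
  /-- Enclosure of the mean-field anomalous density `m₀`. -/
  meanFieldDensity : NonemptyInterval ℚ

namespace HubbardScaleData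

/-! ### The real parameters a scale datum encloses, and model reports -/

/-- The real parameter tuple of a phase + quasiparticle effective action at one infrared scale, on
`Np` Fermi-curve patches: the gap function on the patches, the phase stiffness `ρ_s`, the pair
compressibility `κ`, the nodal velocities `v_F`, `v_Δ`, the remainder norm `η` and the mean-field
anomalous density `m₀`. This is the semantic object a `HubbardScaleData` certificate encloses
(a-posteriori format: Figueras–Haro–Luque 2016, Thm. 2.5; posited by route AposterioriCapRg).
[folklore] -/
structure Parameters (Np : ℕ) where
  /-- The gap function `Δ` evaluated on the `Np` patches. -/
  gap : Fin Np → ℝ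
  /-- The phase stiffness `ρ_s` (helicity modulus). -/
  stiffness : ℝ
  /-- The pair compressibility `κ`. -/
  compressibility : ℝ
  /-- The nodal Fermi velocity `v_F`. -/
  fermiVelocity : ℝ
  /-- The nodal gap velocity `v_Δ`. -/
  gapVelocity : ℝ
  /-- The norm `η` of the remainder (everything not kept). -/
  remainderNorm : ℝ
  /-- The mean-field anomalous density `m₀` of the truncated action. -/
  meanFieldDensity : ℝ

/-- A **scale report** on `Np` patches: for each volume `L` and inverse temperature `β`, the set
of parameter tuples realised by (the phase + quasiparticle form of) a model's effective action at
the scale — the semantic input against which a scale datum is certified (for the route: the report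
of `dWaveSourceTorus L U μ h` at scale `Λ₀`, to be defined from `hubbardEffectiveAction`).
[folklore] -/
abbrev Report (Np : ℕ) : Type :=
  ℕ → ℝ → Set (Parameters Np)

variable (D : HubbardScaleData)

/-- The scale of a scale datum is positive as a real number. [folklore] -/
theorem cast_scale_pos : (0 : ℝ) < D.scale := by exact_mod_cast D.scale_pos

/-- `D.Encloses p`: every coordinate of the real parameter tuple `p` lies in the corresponding
rational interval of the scale datum `D` (Moore's inclusion, coordinatewise).
[cite: Moore1966, Ch. 2] -/
def Encloses (p : Parameters D.numPatches) : Prop :=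
  (∀ i, p.gap i ∈ (D.gap i).ratCast ℝ) ∧
    p.stiffness ∈ D.stiffness.ratCast ℝ ∧
    p.compressibility ∈ D.compressibility.ratCast ℝ ∧
    p.fermiVelocity ∈ D.fermiVelocity.ratCast ℝ ∧
    p.gapVelocity ∈ D.gapVelocity.ratCast ℝ ∧
    p.remainderNorm ∈ D.remainderNorm.ratCast ℝ ∧
    p.meanFieldDensity ∈ D.meanFieldDensity.ratCast ℝ

/-- `D.IsCertifiedEnclosure R L₀`: the scale datum `D` is a certified enclosure of the report
`R` from volume `L₀` on — for every `L ≥ L₀` there is `β₀ = β₀(L)` such that for every `β ≥ β₀`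
some parameter tuple realised at `(L, β)` is enclosed by `D` (one datum, uniformly in `L` and in
`β` large; the a-posteriori hypothesis shape of Figueras–Haro–Luque 2016, Thm. 2.5). [folklore] -/
def IsCertifiedEnclosure (R : Report D.numPatches) (L₀ : ℕ) : Prop :=
  ∀ L : ℕ, L₀ ≤ L → ∃ β₀ : ℝ, ∀ β : ℝ, β₀ ≤ β → ∃ p ∈ R L β, D.Encloses p

/-- `D.MeetsThresholdsWith c K η`: the threshold inequalities of the a-posteriori order criterion
with gap ratio `c`, stiffness threshold `K` and remainder threshold `η`, in worst case over the
enclosures of `D` and in polynomial form: compressibility and velocities positive;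
`K Λ₀ v_F ≤ ρ_s`, `K Λ₀ v_Δ ≤ ρ_s` and `(K Λ₀)² ≤ ρ_s κ` (i.e. `ρ_s/(Λ₀ max(v_F, v_Δ, √(ρ_s/κ)))
≥ K`); `|Δ| ≥ c Λ₀` on every non-nodal patch; `η ≤ η*`. Rational data, hence decidable.
(Thresholds as in route AposterioriCapRg, crux AposterioriOrderCriterion; format Knabe 1988,
Figueras–Haro–Luque 2016 Thm. 2.5.) [folklore] -/
def MeetsThresholdsWith (c Kstar etastar : ℚ) : Prop :=
  0 < D.compressibility.fst ∧ 0 < D.fermiVelocity.fst ∧ 0 < D.gapVelocity.fst ∧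
    Kstar * D.scale * D.fermiVelocity.snd ≤ D.stiffness.fst ∧
    Kstar * D.scale * D.gapVelocity.snd ≤ D.stiffness.fst ∧
    (Kstar * D.scale) ^ 2 ≤ D.stiffness.fst * D.compressibility.fst ∧
    (∀ i, i ∉ D.nodal → c * D.scale ≤ (D.gap i).fst ∨ (D.gap i).snd ≤ -(c * D.scale)) ∧
    D.remainderNorm.snd ≤ etastar

/-- `D.MeetsThresholds K η`: the thresholds of the criterion with the requested gap ratio `10`
(off-nodal gap `≥ 10 Λ₀`). [folklore] -/
def MeetsThresholds (Kstar etastar : ℚ) : Prop :=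
  D.MeetsThresholdsWith 10 Kstar etastar

/-- The threshold predicate is decidable (rational arithmetic over a finite record): concrete
certificates are checked by `decide +kernel`. [folklore] -/
instance instDecidableMeetsThresholdsWith (c Kstar etastar : ℚ) :
    Decidable (D.MeetsThresholdsWith c Kstar etastar) := by
  unfold MeetsThresholdsWith; infer_instance

/-- `MeetsThresholds` is decidable. [folklore] -/
instance instDecidableMeetsThresholds (Kstar etastar : ℚ) :
    Decidable (D.MeetsThresholds Kstar etastar) := by
  unfold MeetsThresholds; infer_instance

/-! ### API -/

variable {D}

/-- Unfolding `MeetsThresholds`. [folklore] -/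
theorem meetsThresholds_iff (Kstar etastar : ℚ) :
    D.MeetsThresholds Kstar etastar ↔ D.MeetsThresholdsWith 10 Kstar etastar := Iff.rfl

/-- Unfolding `IsCertifiedEnclosure`. [folklore] -/
theorem isCertifiedEnclosure_iff (R : Report D.numPatches) (L₀ : ℕ) :
    D.IsCertifiedEnclosure R L₀ ↔
      ∀ L : ℕ, L₀ ≤ L → ∃ β₀ : ℝ, ∀ β : ℝ, β₀ ≤ β → ∃ p ∈ R L β, D.Encloses p := Iff.rfl

/-- A certified enclosure from `L₀` on is one from any later `L₀'` on. [folklore] -/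
theorem IsCertifiedEnclosure.mono {R : Report D.numPatches} {L₀ L₀' : ℕ} (hL : L₀ ≤ L₀')
    (h : D.IsCertifiedEnclosure R L₀) : D.IsCertifiedEnclosure R L₀' :=
  fun L hL' => h L (hL.trans hL')

/-- A certified enclosure of a report is one of any larger report. [folklore] -/
theorem IsCertifiedEnclosure.mono_report {R R' : Report D.numPatches} {L₀ : ℕ}
    (hR : ∀ L β, R L β ⊆ R' L β) (h : D.IsCertifiedEnclosure R L₀) :
    D.IsCertifiedEnclosure R' L₀ := by
  intro L hL
  obtain ⟨β₀, hβ₀⟩ := h L hL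
  refine ⟨β₀, fun β hβ => ?_⟩
  obtain ⟨p, hp, hDp⟩ := hβ₀ β hβ
  exact ⟨p, hR L β hp, hDp⟩

/-- The empty report is never certified (no vacuity through the report). [folklore] -/
theorem not_isCertifiedEnclosure_empty (L₀ : ℕ) :
    ¬ D.IsCertifiedEnclosure (fun _ _ => ∅) L₀ := by
  intro h
  obtain ⟨β₀, hβ₀⟩ := h L₀ le_rfl
  obtain ⟨p, hp, -⟩ := hβ₀ β₀ le_rfl
  exact hp

/-- Weakening the thresholds: a smaller stiffness threshold `0 ≤ K' ≤ K`, a smaller gap ratio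
`c' ≤ c` and a larger remainder threshold `η ≤ η'` are still met. [folklore] -/
theorem MeetsThresholdsWith.mono {c c' K K' η η' : ℚ} (hc : c' ≤ c)
    (hK' : 0 ≤ K') (hK : K' ≤ K) (hη : η ≤ η') (h : D.MeetsThresholdsWith c K η) :
    D.MeetsThresholdsWith c' K' η' := by
  obtain ⟨hκ, hvF, hvΔ, h1, h2, h3, h4, h5⟩ := h
  have hΛ : 0 < D.scale := D.scale_pos
  have hvF' : 0 ≤ D.fermiVelocity.snd := hvF.le.trans D.fermiVelocity.fst_le_snd
  have hvΔ' : 0 ≤ D.gapVelocity.snd := hvΔ.le.trans D.gapVelocity.fst_le_snd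
  refine ⟨hκ, hvF, hvΔ, ?_, ?_, ?_, ?_, h5.trans hη⟩
  · exact (mul_le_mul_of_nonneg_right (mul_le_mul_of_nonneg_right hK hΛ.le) hvF').trans h1
  · exact (mul_le_mul_of_nonneg_right (mul_le_mul_of_nonneg_right hK hΛ.le) hvΔ').trans h2
  · refine le_trans ?_ h3
    have : K' * D.scale ≤ K * D.scale := mul_le_mul_of_nonneg_right hK hΛ.le
    exact pow_le_pow_left₀ (mul_nonneg hK' hΛ.le) this 2
  · intro i hi
    have hcc : c' * D.scale ≤ c * D.scale := mul_le_mul_of_nonneg_right hc hΛ.le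
    rcases h4 i hi with h | h
    · exact Or.inl (hcc.trans h)
    · exact Or.inr (h.trans (neg_le_neg hcc))

/-- Weakening the thresholds of `MeetsThresholds`. [folklore] -/
theorem MeetsThresholds.mono {K K' η η' : ℚ} (hK' : 0 ≤ K') (hK : K' ≤ K) (hη : η ≤ η')
    (h : D.MeetsThresholds K η) : D.MeetsThresholds K' η' :=
  MeetsThresholdsWith.mono le_rfl hK' hK hη h

/-- Under the thresholds with `K > 0` the certified stiffness is positive. [folklore] -/
theorem MeetsThresholdsWith.stiffness_pos {c K η : ℚ} (hK : 0 < K)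
    (h : D.MeetsThresholdsWith c K η) : 0 < D.stiffness.fst := by
  obtain ⟨-, hvF, -, h1, -⟩ := h
  have : 0 < K * D.scale * D.fermiVelocity.snd :=
    mul_pos (mul_pos hK D.scale_pos) (hvF.trans_le D.fermiVelocity.fst_le_snd)
  exact this.trans_le h1

/-! ### From a checked certificate to real inequalities on enclosed parameters -/

section Pointwise

variable {c K η : ℚ} {p : Parameters D.numPatches}

/-- Enclosed parameters under the thresholds: `K Λ₀ v_F ≤ ρ_s`. [folklore] -/
theorem MeetsThresholdsWith.stiffness_ge_fermiVelocity (h : D.MeetsThresholdsWith c K η)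
    (hp : D.Encloses p) (hK : 0 ≤ K) :
    (K : ℝ) * D.scale * p.fermiVelocity ≤ p.stiffness := by
  obtain ⟨-, -, -, h1, -⟩ := h
  obtain ⟨-, hρ, -, hvF, -⟩ := hp
  rw [mem_ratCast_iff] at hρ hvF
  have h1' : ((K * D.scale * D.fermiVelocity.snd : ℚ) : ℝ) ≤ (D.stiffness.fst : ℝ) :=
    Rat.cast_le.2 h1
  push_cast at h1'
  have hKΛ : (0 : ℝ) ≤ K * D.scale :=
    mul_nonneg (by exact_mod_cast hK) (by exact_mod_cast D.scale_pos.le)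
  exact ((mul_le_mul_of_nonneg_left hvF.2 hKΛ).trans h1').trans hρ.1

/-- Enclosed parameters under the thresholds: `K Λ₀ v_Δ ≤ ρ_s`. [folklore] -/
theorem MeetsThresholdsWith.stiffness_ge_gapVelocity (h : D.MeetsThresholdsWith c K η)
    (hp : D.Encloses p) (hK : 0 ≤ K) :
    (K : ℝ) * D.scale * p.gapVelocity ≤ p.stiffness := by
  obtain ⟨-, -, -, -, h2, -⟩ := h
  obtain ⟨-, hρ, -, -, hvΔ, -⟩ := hp
  rw [mem_ratCast_iff] at hρ hvΔ
  have h2' : ((K * D.scale * D.gapVelocity.snd : ℚ) : ℝ) ≤ (D.stiffness.fst : ℝ) :=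
    Rat.cast_le.2 h2
  push_cast at h2'
  have hKΛ : (0 : ℝ) ≤ K * D.scale :=
    mul_nonneg (by exact_mod_cast hK) (by exact_mod_cast D.scale_pos.le)
  exact ((mul_le_mul_of_nonneg_left hvΔ.2 hKΛ).trans h2').trans hρ.1

/-- Enclosed parameters under the thresholds: `(K Λ₀)² ≤ ρ_s κ` (the phase-velocity condition
`ρ_s / (Λ₀ √(ρ_s/κ)) = √(ρ_s κ)/Λ₀ ≥ K`), and `κ > 0`. [folklore] -/
theorem MeetsThresholdsWith.sq_le_stiffness_mul_compressibility (h : D.MeetsThresholdsWith c K η)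
    (hp : D.Encloses p) (hK : 0 ≤ K) :
    ((K : ℝ) * D.scale) ^ 2 ≤ p.stiffness * p.compressibility ∧ 0 < p.compressibility := by
  obtain ⟨hκ, hvF, -, h1, -, h3, -⟩ := h
  obtain ⟨-, hρ, hκp, -⟩ := hp
  rw [mem_ratCast_iff] at hρ hκp
  have hρ0 : (0 : ℚ) ≤ D.stiffness.fst := by
    have : 0 ≤ K * D.scale * D.fermiVelocity.snd :=
      mul_nonneg (mul_nonneg hK D.scale_pos.le) (hvF.le.trans D.fermiVelocity.fst_le_snd)
    exact this.trans h1
  have h3' : (((K * D.scale) ^ 2 : ℚ) : ℝ) ≤ ((D.stiffness.fst * D.compressibility.fst : ℚ) : ℝ) :=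
    Rat.cast_le.2 h3
  push_cast at h3'
  have hκpos : (0 : ℝ) < p.compressibility :=
    (by exact_mod_cast hκ : (0 : ℝ) < D.compressibility.fst).trans_le hκp.1
  refine ⟨h3'.trans ?_, hκpos⟩
  have hρ0' : (0 : ℝ) ≤ D.stiffness.fst := by exact_mod_cast hρ0
  calc (D.stiffness.fst : ℝ) * D.compressibility.fst
      ≤ D.stiffness.fst * p.compressibility := mul_le_mul_of_nonneg_left hκp.1 hρ0'
    _ ≤ p.stiffness * p.compressibility := mul_le_mul_of_nonneg_right hρ.1 hκpos.le

/-- Enclosed parameters under the thresholds: the gap is at least `c Λ₀` in absolute value on every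
non-nodal patch. [folklore] -/
theorem MeetsThresholdsWith.le_abs_gap (h : D.MeetsThresholdsWith c K η) (hp : D.Encloses p)
    {i : Fin D.numPatches} (hi : i ∉ D.nodal) :
    (c : ℝ) * D.scale ≤ |p.gap i| := by
  obtain ⟨-, -, -, -, -, -, h4, -⟩ := h
  obtain ⟨hg, -⟩ := hp
  have hgi := hg i
  rw [mem_ratCast_iff] at hgi
  rcases h4 i hi with h | h
  · have h' : ((c * D.scale : ℚ) : ℝ) ≤ (D.gap i).fst := Rat.cast_le.2 h
    push_cast at h'
    exact (h'.trans hgi.1).trans (le_abs_self _)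
  · have h' : ((D.gap i).snd : ℝ) ≤ ((-(c * D.scale) : ℚ) : ℝ) := Rat.cast_le.2 h
    push_cast at h'
    have : (c : ℝ) * D.scale ≤ -p.gap i := by linarith [hgi.2]
    exact this.trans (neg_le_abs _)

/-- Enclosed parameters under the thresholds: the remainder norm is at most `η`. [folklore] -/
theorem MeetsThresholdsWith.remainderNorm_le (h : D.MeetsThresholdsWith c K η)
    (hp : D.Encloses p) : p.remainderNorm ≤ (η : ℝ) := by
  obtain ⟨-, -, -, -, -, -, -, h5⟩ := h
  obtain ⟨-, -, -, -, -, hη, -⟩ := hp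
  rw [mem_ratCast_iff] at hη
  exact hη.2.trans (Rat.cast_le.2 h5)

/-- Enclosed parameters: the mean-field density is at least the certified lower end point (the
number an order criterion turns into a lower bound on the order parameter). [folklore] -/
theorem Encloses.fst_le_meanFieldDensity (hp : D.Encloses p) :
    ((D.meanFieldDensity.fst : ℚ) : ℝ) ≤ p.meanFieldDensity := by
  obtain ⟨-, -, -, -, -, -, hm⟩ := hp
  rw [mem_ratCast_iff] at hm
  exact hm.1

end Pointwise

end HubbardScaleData

/-! ### A concrete certificate is checked by `decide +kernel` (format demonstration)

A toy scale datum on two patches (patch `0` nodal, scale `Λ₀ = 1/100`) meets the thresholds with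
`K = 20`, `η* = 1/500` (with `K = 30` the same command refutes them), COMPUTED in the kernel as in
`Literature.Analysis.ValidatedNumerics.Certificate`. No model content. -/

example :
    (HubbardScaleData.mk (1 / 100) (by norm_num) 2 {0}
        ![⟨(0, 1 / 1000), by norm_num⟩, ⟨(1 / 5, 1 / 4), by norm_num⟩]
        ⟨(1 / 2, 1), by norm_num⟩ ⟨(1, 2), by norm_num⟩ ⟨(1, 2), by norm_num⟩
        ⟨(1 / 10, 1 / 5), by norm_num⟩ ⟨(0, 1 / 1000), by norm_num⟩
        ⟨(1 / 20, 1 / 10), by norm_num⟩).MeetsThresholds 20 (1 / 500) := by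
  decide +kernel

end Literature.MathematicalPhysics.QuantumLattice
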